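import Summits.AtomisticToContinuum.FouriersLaw.Theorems.BondHeatUncertaintyBoundedResponseBathHeatCumulant
import Summits.AtomisticToContinuum.FouriersLaw.Theorems.BondHeatUncertaintySubdiffusiveBondHeatDeficitCesaroLinear
import HarnessLib

/-!
(SPLIT FOR THE 400-LINE CAP by the landing lane, hand-2 g40: this file = part 1 of 2; sequels `…BondHeatUncertaintyBoundedResponseBathHeatLateTail` import it in a chain; same namespace, all FQNs unchanged.)
# BondHeatUncertainty / BoundedResponse — «LateTail»: the Ohmic floor is BLIND TO THE LIGHT CONE (lens-1 «grading», gen 109)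

Decomposition node beneath the blocker `stmt-AtomisticToContinuum-11071` (`BondHeatUncertainty.BoundedResponse` ⟺ `OhmicFloor`,
`E_N ≤ C₁/N`), on the door of record `11071 ⟸ (S) ∧ (BTᶠ_1)` (`…BathHeatE.boundedResponse_of_bathHeatPoint_bathTailFloor` +
`bathHeatPoint_one_of_subdiffusiveBondHeat`; (S) = crux 9120 `SubdiffusiveBondHeat`, (BTᶠ_1) = `BathTailFloor 1`:
`B_N(cN²) := γ²∫_{(0,∞)} min(r,cN²) K_N(r) dr ≥ −C·N`, `K_N(r) = ⟨p₀² − T, P_r(p₀² − T)⟩_{μ_T}` the boundary kinetic memory kernel),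
and beneath NODE 108 (`…BathHeatCumulant*`: `(BTᶠ_1) ⟸ (BKᶠ_{0,3/2}) ⟸ (CPᶠ_{0,3/2}) ∧ (VCᶠ_{0,3/2})`, residual (VCᶠ) IDEA-NEEDED, critic row 1491).

QUESTION OF THE LENS (grading by the TIME-WINDOW exponent `b`: which lags `r ≲ N^b` of `K_N` can the floor at grade `g` afford to
ignore, and where do the theorems stop?).  ANSWER, PROVED HERE FROM THE TREE ALONE (no new hypothesis):

★ `abs_bathTailEarly_le` — the HAT-WEIGHTED early mass `B^early_N(s) := 2B_N(s) − B_N(2s) = γ²∫ hat_s·K_N`, `hat_s(r) = min(r, 2s − r)₊ =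
  2min(r,s) − min(r,2s)` (supported on `(0,2s)`, `= r` on `(0,s]`), obeys `|B^early_N(s)| ≤ 2γT²·s` for EVERY `s ≥ 0` and EVERY `N ≥ 2` —
  two instances of the thermodynamic sandwich `−t·γT²E_N ≤ B_N(t) ≤ t·γT²(1 − E_N)` (lower = `W_N ≥ 0`, `…BathHeatE.neg_mul_escapeDeficit_le_bathTail`;
  upper = Fejér positivity `∫₀ᵗ(t − r)K_N ≥ 0`, `…DeficitCesaroLinear.pinnedChain_primitive_kinKernel_integral_nonneg`, typed here as
  `bathTail_le_mul_one_sub_escapeDeficit`).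
★★ `lateTailFloor_iff_bathTailFloor` — hence for every `a ≥ 0` and every window exponent `b ≤ g`:
  `BathTailFloor g ⟺ LateTailFloor a b g`, where `LateTailFloor a b g` floors ONLY the LATE functional
  `B^late_N(s,t) := B_N(t) − B^early_N(s) = γ²∫ ℓ_{s,t}·K_N` (`bathTailLate_eq_integral`) whose weight `ℓ_{s,t} = min(·,t) − hat_s` VANISHES on
  `(0,s]` (`lateWeight_eq_zero`), is `≥ 0` and `≤ min(·,t)` (`2s ≤ t`), and equals `min(·,t)` beyond `2s`.  THE FREE WINDOW EXPONENT EQUALS THE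
  GRADE: at the Ohmic grade `g = 1` the floor is blind to every lag `r ≤ aN` — the whole LIGHT CONE (kinetic times, mesoscopic dephasing, the
  first sound traversal) carries no information for the blocker; only ECHO / HYDRODYNAMIC / THOULESS lags `r ≳ N` decide it.  (At `g = 2`,
  blind up to the Thouless time itself: `bathTailFloor_two` is the degenerate rung.)
★ `lateTailFloor_one_of_lateNegMass` — the natural one-sided supplier is the LATE NEGATIVE MASS
  `𝔐_N(a,c) := ∫_{(aN,∞)} min(r,cN²)·K_N(r)⁻ dr`: `γ²𝔐_N(a,c) ≤ C·N` (`LateNegMass a`) gives `LateTailFloor a 1 1`, hence with (S) the blocker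
  (`boundedResponse_of_subdiffusiveBondHeat_lateNegMass`).  It is implied by EVERY pointwise late floor `K_N(r) ≥ −A·N^p·r^{−α}` on `r ≥ aN`
  (`LateKernelFloor a p α`) in the ADMISSIBLE REGION `{α > 2, p ≤ α − 1} ∪ {1 < α < 2, p ≤ 2α − 3}` (`lateNegMass_of_lateKernelFloor_of_two_lt`,
  `lateNegMass_of_lateKernelFloor_of_lt_two`): besides the door of record's `(0, 3/2)` (`lateKernelFloor_of_bathKernelFloor`) the region contains the
  ECHO-TOLERANT family `(α − 1, α)`, `α > 2`: `K_N(r) ≥ −(A/N)·(N/r)^α` — negative echo lobes of depth `A/N` at the sound-traversal lags `r ≍ N` are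
  ADMISSIBLE provided the `k`-th echo's negative lobe decays faster than `k^{−2}`; `(0, 3/2)` instead demands `−A·N^{−3/2}` there (echo-INtolerant) but is
  laxer at Thouless lags.  By NODE 108's exact split `K_N = CP_N + VC_N` the late floors may be asked of the two CHANNELS separately
  (`lateKernelFloor_of_lateChannelFloors`): the critic's 1a «LocalEquilibriumChannel» is `LateVarChannelFloor` — (VCᶠ) posed on hydrodynamic lags only,
  where the conditional variance of the boundary momentum IS the local kinetic temperature and `VC_N(r) = Cov(p₀(0)², T₀(r | ·))` is the heat-return
  correlation.

TAGS.  `bathTail_le_mul_one_sub_escapeDeficit`, `abs_bathTailEarly_le`, `bathTailLate_eq_integral`, `lateTailFloor_iff_bathTailFloor`: KNOWN (proved,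
tree only).  `LateTailFloor a 1 1`: ⟺ (BTᶠ_1) (EQUIV — the one language change of this chain: same strength, new ADDRESS `r ≥ aN`), hence WEAKER
than 11071 (`lateTailFloor_of_boundedResponse`) and, beneath (S), ⟺ 11071 (`boundedResponse_iff_lateTailFloor_of_subdiffusiveBondHeat`).
`LateNegMass a`: UNDECIDED · phonon-TRUE (`K_N ≥ 0`, Wick) · INCOMPARABLE with 11071 (one-sided, integrated; does not force `E_N → 0`) ·
INSTRUMENTABLE (NEGMASS-109: re-analysis of the retained GKTAIL kernels, zero new dynamics) · weaker than every admissible `LateKernelFloor`, than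
(BKᶠ_{0,3/2}), than (BK⁺).  `LateKernelFloor a (α−1) α` (`α > 2`): UNDECIDED · phonon-TRUE · INSTRUMENTABLE (ECHO-109) · CONJECTURAL (chaotic regime:
echoes damped on the mean free path).  `LateVarChannelFloor`/`LateCommonPastFloor`: the g108 channel tags, restricted.  Nothing here is a literature
fact; every `def … : Prop` is a route statement of this cell.  No `sorry`, no new axioms.
-/

noncomputable section

open MeasureTheory ProbabilityTheory Filter Topology Set Function
open scoped NNReal ENNReal
open Literature.MathematicalPhysics.KineticTheory.HeatConduction
open Literature.MathematicalPhysics.KineticTheory OscillatorChain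
open Literature.Probability.Process
open Summit.AtomisticToContinuum.FouriersLaw.Theorems.SubdiffusiveBondHeat
open Summit.AtomisticToContinuum.FouriersLaw.Theorems.SubdiffusiveBondHeat.EscapeGrading

namespace Summit.AtomisticToContinuum.FouriersLaw.Theorems.BoundedResponse.HeatSpreading

open Summit.AtomisticToContinuum.FouriersLaw.Theses.BondHeatUncertainty (BoundedResponse SubdiffusiveBondHeat)

/-! ## §1 The hat-weighted early mass and the late functional -/

/-- **`B^early_N(s) := 2B_N(s) − B_N(2s)`** `= γ² ∫_{(0,∞)} hat_s(r) K_N(r) dr`, `hat_s(r) = 2min(r,s) − min(r,2s) = min(r, 2s − r)₊`: the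
HAT-WEIGHTED mass of the boundary kernel on the early window `(0, 2s)`. [formal bookkeeping] -/
def bathTailEarly (ω₂ lam β γ T : ℝ) (N : ℕ) (s : ℝ) : ℝ :=
  2 * bathTail ω₂ lam β γ T N s - bathTail ω₂ lam β γ T N (2 * s)

/-- **`B^late_N(s,t) := B_N(t) − B^early_N(s)`** `= γ² ∫_{(0,∞)} ℓ_{s,t}(r) K_N(r) dr` with the LATE WEIGHT `ℓ_{s,t}` (zero on `(0,s]`).
[formal bookkeeping] -/
def bathTailLate (ω₂ lam β γ T : ℝ) (N : ℕ) (s t : ℝ) : ℝ :=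
  bathTail ω₂ lam β γ T N t - bathTailEarly ω₂ lam β γ T N s

/-- The late weight `ℓ_{s,t}(r) := min(r,t) − (2min(r,s) − min(r,2s))`: `0` on `[0,s]`, `2(r − s)` on `[s,2s]`, `min(r,t)` on `[2s,∞)` (`2s ≤ t`).
[formal bookkeeping] -/
def lateWeight (s t r : ℝ) : ℝ :=
  min r t - (2 * min r s - min r (2 * s))

/-- `bathTail_eq_early_add_late` (docstring added by the landing lane; see the module docstring). [formal bookkeeping] -/
theorem bathTail_eq_early_add_late (ω₂ lam β γ T : ℝ) (N : ℕ) (s t : ℝ) :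
    bathTail ω₂ lam β γ T N t = bathTailEarly ω₂ lam β γ T N s + bathTailLate ω₂ lam β γ T N s t := by
  unfold bathTailLate; ring

/-- `lateWeight_eq_zero` (docstring added by the landing lane; see the module docstring). [formal bookkeeping] -/
theorem lateWeight_eq_zero {s t r : ℝ} (hs : 0 ≤ s) (hrs : r ≤ s) (hrt : r ≤ t) : lateWeight s t r = 0 := by
  unfold lateWeight
  rw [min_eq_left hrt, min_eq_left hrs, min_eq_left (by linarith : r ≤ 2 * s)]
  ring

/-- `lateWeight_eq_min` (docstring added by the landing lane; see the module docstring). [formal bookkeeping] -/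
theorem lateWeight_eq_min {s t r : ℝ} (hs : 0 ≤ s) (hr : 2 * s ≤ r) : lateWeight s t r = min r t := by
  unfold lateWeight
  rw [min_eq_right (by linarith : s ≤ r), min_eq_right hr]
  ring

/-- `hatWeight_nonneg` (docstring added by the landing lane; see the module docstring). [formal bookkeeping] -/
theorem hatWeight_nonneg {s r : ℝ} (hs : 0 ≤ s) (hr : 0 ≤ r) : 0 ≤ 2 * min r s - min r (2 * s) := by
  rcases le_total r s with h | h
  · rw [min_eq_left h, min_eq_left (by linarith : r ≤ 2 * s)]; linarith
  · rw [min_eq_right h]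
    rcases le_total r (2 * s) with h' | h'
    · rw [min_eq_left h']; linarith
    · rw [min_eq_right h']; linarith

/-- `hatWeight_le` (docstring added by the landing lane; see the module docstring). [formal bookkeeping] -/
theorem hatWeight_le {s r : ℝ} (hs : 0 ≤ s) : 2 * min r s - min r (2 * s) ≤ min r s := by
  rcases le_total r s with h | h
  · rw [min_eq_left h, min_eq_left (by linarith : r ≤ 2 * s)]; linarith
  · rw [min_eq_right h]
    rcases le_total r (2 * s) with h' | h'
    · rw [min_eq_left h']; linarith
    · rw [min_eq_right h']; linarith

/-- `lateWeight_le_min` (docstring added by the landing lane; see the module docstring). [formal bookkeeping] -/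
theorem lateWeight_le_min {s t r : ℝ} (hs : 0 ≤ s) (hr : 0 ≤ r) : lateWeight s t r ≤ min r t := by
  unfold lateWeight; linarith [hatWeight_nonneg hs hr]

/-- `lateWeight_nonneg` (docstring added by the landing lane; see the module docstring). [formal bookkeeping] -/
theorem lateWeight_nonneg {s t r : ℝ} (hs : 0 ≤ s) (hst : 2 * s ≤ t) (hr : 0 ≤ r) : 0 ≤ lateWeight s t r := by
  rcases le_total r (2 * s) with h | h
  · -- on `[0,2s]`: `min(r,t) = r` and the hat is `≤ min(r,s) ≤ r`
    unfold lateWeight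
    rw [min_eq_left (le_trans h hst)]
    linarith [hatWeight_le (r := r) hs, min_le_left r s]
  · rw [lateWeight_eq_min hs h]
    exact le_min hr (by linarith)

/-- `continuous_lateWeight` (docstring added by the landing lane; see the module docstring). [formal bookkeeping] -/
theorem continuous_lateWeight (s t : ℝ) : Continuous (lateWeight s t) := by
  unfold lateWeight; fun_prop

section Early

variable {ω₂ lam β γ : ℝ} (hω : 0 < ω₂) (hl : 0 < lam) (hβ : 0 < β) (hγ : 0 < γ) {T : ℝ} (hT : 0 < T)
include hω hl hβ hγ hT

/-- **Fejér half of the sandwich**: `B_N(t) ≤ t·γT²·(1 − E_N)` (`N ≥ 1`, `t ≥ 0`) — `B_N(t) = γ²(t∫K_N − ∫₀ᵗ(t−r)K_N)`, `γ²∫K_N = γT²(1 − E_N)` and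
`∫₀ᵗ (t − r) K_N(r) dr = ½·E_{μ_T⊗W}[(∫₀ᵗ (p₀² − T)(z_s) ds)²] ≥ 0` (tree). [folklore] -/
theorem bathTail_le_mul_one_sub_escapeDeficit {N : ℕ} (hN : 0 < N) {t : ℝ} (ht : 0 ≤ t) :
    bathTail ω₂ lam β γ T N t ≤ t * (γ * T ^ 2 * (1 - escapeDeficit ω₂ lam β γ T N)) := by
  have hK := (bathKinCorr_basics hω hl hβ hγ hT hN).2.2
  have hsplit := TransientBand.integral_min_mul_eq_sub hK ht
  have hF : 0 ≤ ∫ r in (0:ℝ)..t, (t - r) * bathKinCorr ω₂ lam β γ T N r := by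
    have h1 := pinnedChain_primitive_kinKernel_integral_nonneg hω hl hβ hγ hT hN ht
    have h2 := pinnedChain_primitive_kinKernel_integral_eq hω hl hβ hγ hT hN ht
    simp only [bathKinCorr, dif_pos hN]
    rw [← h2]
    exact h1
  have hE : γ * T ^ 2 * (1 - escapeDeficit ω₂ lam β γ T N) = γ ^ 2 * ∫ u in Ioi (0:ℝ), bathKinCorr ω₂ lam β γ T N u := by
    rw [escapeDeficit_eq_bathKinCorr]
    have hT2 : T ^ 2 ≠ 0 := by positivity
    field_simp
    ring
  unfold bathTail
  rw [hsplit, hE]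
  nlinarith [mul_nonneg (sq_nonneg γ) hF]

/-- ★ **THE EARLY MASS IS THERMODYNAMICALLY SANDWICHED**: `|2B_N(s) − B_N(2s)| ≤ 2γT²·s` for every `s ≥ 0`, `N ≥ 2` — uniformly in `N`, with no
decay input: `−sγT²E_N ≤ B_N(s)` and `B_N(2s) ≤ 2sγT²(1 − E_N)` bound it below by `−2sγT²`, the mirror instances above by `2sγT²`. [this cell] -/
theorem abs_bathTailEarly_le {N : ℕ} (hN : 1 < N) {s : ℝ} (hs : 0 ≤ s) :
    |bathTailEarly ω₂ lam β γ T N s| ≤ 2 * γ * T ^ 2 * s := by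
  have hN0 : 0 < N := Nat.zero_lt_of_lt hN
  have h2s : (0:ℝ) ≤ 2 * s := by positivity
  have hlo1 := (neg_mul_escapeDeficit_le_bathTail hω hl hβ hγ hT hN hs).1
  have hlo2 := (neg_mul_escapeDeficit_le_bathTail hω hl hβ hγ hT hN h2s).1
  have hup1 := bathTail_le_mul_one_sub_escapeDeficit hω hl hβ hγ hT hN0 hs
  have hup2 := bathTail_le_mul_one_sub_escapeDeficit hω hl hβ hγ hT hN0 h2s
  unfold bathTailEarly
  rw [abs_le]
  constructor <;> nlinarith

/-- `min(r,t)·K_N` restricted: integrable on `(s,∞)` for `s ≥ 0`. [folklore] -/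
theorem integrableOn_min_mul_bathKinCorr_Ioi {N : ℕ} (hN : 0 < N) {s t : ℝ} (hs : 0 ≤ s) (ht : 0 ≤ t) :
    IntegrableOn (fun r : ℝ => min r t * bathKinCorr ω₂ lam β γ T N r) (Ioi s) :=
  (integrableOn_min_mul_bathKinCorr hω hl hβ hγ hT hN ht).mono_set (Ioi_subset_Ioi hs)

/-- `ℓ_{s,t}·K_N` is integrable on `(0,∞)` (`s,t ≥ 0`). [folklore] -/
theorem integrableOn_lateWeight_mul_bathKinCorr {N : ℕ} (hN : 0 < N) {s t : ℝ} (hs : 0 ≤ s) (ht : 0 ≤ t) :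
    IntegrableOn (fun r : ℝ => lateWeight s t r * bathKinCorr ω₂ lam β γ T N r) (Ioi 0) := by
  have h1 := integrableOn_min_mul_bathKinCorr hω hl hβ hγ hT hN ht
  have h2 := integrableOn_min_mul_bathKinCorr hω hl hβ hγ hT hN hs
  have h3 := integrableOn_min_mul_bathKinCorr hω hl hβ hγ hT hN (show (0:ℝ) ≤ 2 * s by positivity)
  have h := h1.sub ((h2.const_mul 2).sub h3)
  refine h.congr_fun (fun r _ => ?_) measurableSet_Ioi
  simp only [lateWeight, Pi.sub_apply]
  ring

/-- ★ **The late functional is the kernel's `ℓ`-weighted mass**: `B^late_N(s,t) = γ²∫_{(0,∞)} ℓ_{s,t}(r) K_N(r) dr` (`N ≥ 1`, `s,t ≥ 0`). [this cell] -/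
theorem bathTailLate_eq_integral {N : ℕ} (hN : 0 < N) {s t : ℝ} (hs : 0 ≤ s) (ht : 0 ≤ t) :
    bathTailLate ω₂ lam β γ T N s t = γ ^ 2 * ∫ r in Ioi (0:ℝ), lateWeight s t r * bathKinCorr ω₂ lam β γ T N r := by
  have h1 := integrableOn_min_mul_bathKinCorr hω hl hβ hγ hT hN ht
  have h2 := integrableOn_min_mul_bathKinCorr hω hl hβ hγ hT hN hs
  have h3 := integrableOn_min_mul_bathKinCorr hω hl hβ hγ hT hN (show (0:ℝ) ≤ 2 * s by positivity)
  have e : (fun r : ℝ => lateWeight s t r * bathKinCorr ω₂ lam β γ T N r) = fun r =>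
      min r t * bathKinCorr ω₂ lam β γ T N r -
        (2 * (min r s * bathKinCorr ω₂ lam β γ T N r) - min r (2 * s) * bathKinCorr ω₂ lam β γ T N r) := by
    funext r; simp only [lateWeight]; ring
  have hX : Integrable (fun r : ℝ => 2 * (min r s * bathKinCorr ω₂ lam β γ T N r) - min r (2 * s) * bathKinCorr ω₂ lam β γ T N r)
      (volume.restrict (Ioi (0:ℝ))) := (h2.const_mul 2).sub h3
  have hI : ∫ r in Ioi (0:ℝ), lateWeight s t r * bathKinCorr ω₂ lam β γ T N r =
      (∫ r in Ioi (0:ℝ), min r t * bathKinCorr ω₂ lam β γ T N r) -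
        (2 * (∫ r in Ioi (0:ℝ), min r s * bathKinCorr ω₂ lam β γ T N r) -
          ∫ r in Ioi (0:ℝ), min r (2 * s) * bathKinCorr ω₂ lam β γ T N r) := by
    rw [e, integral_sub h1 hX, integral_sub (h2.const_mul 2) h3, integral_const_mul]
  unfold bathTailLate bathTailEarly bathTail
  rw [hI]
  ring

/-- The early mass likewise: `B^early_N(s) = γ²∫_{(0,∞)} (2min(r,s) − min(r,2s)) K_N(r) dr`. [formal bookkeeping] -/
theorem bathTailEarly_eq_integral {N : ℕ} (hN : 0 < N) {s : ℝ} (hs : 0 ≤ s) :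
    bathTailEarly ω₂ lam β γ T N s = γ ^ 2 * ∫ r in Ioi (0:ℝ), (2 * min r s - min r (2 * s)) * bathKinCorr ω₂ lam β γ T N r := by
  have h2 := integrableOn_min_mul_bathKinCorr hω hl hβ hγ hT hN hs
  have h3 := integrableOn_min_mul_bathKinCorr hω hl hβ hγ hT hN (show (0:ℝ) ≤ 2 * s by positivity)
  have e : (fun r : ℝ => (2 * min r s - min r (2 * s)) * bathKinCorr ω₂ lam β γ T N r) = fun r =>
      2 * (min r s * bathKinCorr ω₂ lam β γ T N r) - min r (2 * s) * bathKinCorr ω₂ lam β γ T N r := by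
    funext r; ring
  unfold bathTailEarly bathTail
  rw [e, integral_sub (h2.const_mul 2) h3, integral_const_mul]
  ring

end Early

/-! ## §2 The late floors and LIGHT-CONE BLINDNESS -/

/-- **`LateTailFloor a b g`** — the floor at grade `g` on the LATE functional with window `s = a·N^b`: `∀ c > 0 ∃ C N₀ ∀ N ≥ N₀,
B^late_N(aN^b, cN²) ≥ −C·N^g`.  For `2aN^b ≤ cN²` this is a statement about `K_N` on the lags `r ≥ aN^b` ONLY (`lateWeight_eq_zero`).
At `(a,b,g) = (a,1,1)`: the residual beneath (S) re-addressed to echo / hydrodynamic / Thouless lags.  Tag: ⟺ `BathTailFloor g` whenever `b ≤ g`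
(`lateTailFloor_iff_bathTailFloor`) — EQUIV, same tags as (BTᶠ_g). [route statement · this cell; NOT a literature fact] -/
def LateTailFloor (a b g : ℝ) : Prop :=
  ∀ ω₂ lam β γ : ℝ, 0 < ω₂ → 0 < lam → 0 < β → 0 < γ → ∀ T : ℝ, 0 < T → ∀ c : ℝ, 0 < c →
    ∃ C : ℝ, ∃ N₀ : ℕ, ∀ N : ℕ, N₀ ≤ N →
      -(C * (N : ℝ) ^ g) ≤ bathTailLate ω₂ lam β γ T N (a * (N : ℝ) ^ b) (c * (N : ℝ) ^ 2)

/-- ★★ **LIGHT-CONE BLINDNESS (graded)**: for `a ≥ 0` and every window exponent `b ≤ g`, `LateTailFloor a b g ⟺ BathTailFloor g` — the early mass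
`|B^early_N(aN^b)| ≤ 2γT²a·N^b ≤ 2γT²a·N^g` is free.  THE FREE WINDOW EXPONENT EQUALS THE GRADE; at the Ohmic grade the first `aN` lags of `K_N`
carry no information. [this cell] -/
theorem lateTailFloor_iff_bathTailFloor {a b g : ℝ} (ha : 0 ≤ a) (hbg : b ≤ g) : LateTailFloor a b g ↔ BathTailFloor g := by
  constructor
  · intro hL ω₂ lam β γ hω hl hβ hγ T hT c hc
    obtain ⟨C, N₀, hC⟩ := hL ω₂ lam β γ hω hl hβ hγ T hT c hc
    refine ⟨C + 2 * γ * T ^ 2 * a, max N₀ 2, fun N hN => ?_⟩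
    have hNN₀ : N₀ ≤ N := le_trans (le_max_left _ _) hN
    have hN2 : 1 < N := lt_of_lt_of_le (by norm_num) (le_trans (le_max_right _ _) hN)
    have hN1 : (1:ℝ) ≤ N := by exact_mod_cast hN2.le
    have hs : 0 ≤ a * (N : ℝ) ^ b := mul_nonneg ha (Real.rpow_nonneg (by positivity) _)
    have hE := abs_bathTailEarly_le hω hl hβ hγ hT hN2 hs
    have hbg' : (N : ℝ) ^ b ≤ (N : ℝ) ^ g := Real.rpow_le_rpow_of_exponent_le hN1 hbg
    have hlate := hC N hNN₀
    rw [bathTail_eq_early_add_late ω₂ lam β γ T N (a * (N : ℝ) ^ b)]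
    have h1 := (abs_le.1 hE).1
    have hγT : 0 ≤ 2 * γ * T ^ 2 * a := by positivity
    nlinarith [mul_le_mul_of_nonneg_left hbg' hγT]
  · intro hB ω₂ lam β γ hω hl hβ hγ T hT c hc
    obtain ⟨C, N₀, hC⟩ := hB ω₂ lam β γ hω hl hβ hγ T hT c hc
    refine ⟨C + 2 * γ * T ^ 2 * a, max N₀ 2, fun N hN => ?_⟩
    have hNN₀ : N₀ ≤ N := le_trans (le_max_left _ _) hN
    have hN2 : 1 < N := lt_of_lt_of_le (by norm_num) (le_trans (le_max_right _ _) hN)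
    have hN1 : (1:ℝ) ≤ N := by exact_mod_cast hN2.le
    have hs : 0 ≤ a * (N : ℝ) ^ b := mul_nonneg ha (Real.rpow_nonneg (by positivity) _)
    have hE := abs_bathTailEarly_le hω hl hβ hγ hT hN2 hs
    have hbg' : (N : ℝ) ^ b ≤ (N : ℝ) ^ g := Real.rpow_le_rpow_of_exponent_le hN1 hbg
    have htot := hC N hNN₀
    rw [bathTail_eq_early_add_late ω₂ lam β γ T N (a * (N : ℝ) ^ b)] at htot
    have h1 := (abs_le.1 hE).2
    have hγT : 0 ≤ 2 * γ * T ^ 2 * a := by positivity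
    nlinarith [mul_le_mul_of_nonneg_left hbg' hγT]

/-- **11071 ⟹ `LateTailFloor a b 1`** (`a ≥ 0`, `b ≤ 1`): WEAKER certified (`bathTailFloor_one_of_boundedResponse`). [this cell] -/
theorem lateTailFloor_of_boundedResponse {a b : ℝ} (ha : 0 ≤ a) (hb : b ≤ 1) (hB : BoundedResponse) : LateTailFloor a b 1 :=
  (lateTailFloor_iff_bathTailFloor ha hb).2 (bathTailFloor_one_of_boundedResponse hB)

/-- ★★ **THE DOOR, RE-ADDRESSED: (S) ∧ `LateTailFloor a b 1` ⟹ 11071** (`a ≥ 0`, `b ≤ 1`) — beneath (S) the blocker is a floor on the boundary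
kernel's `ℓ`-weighted mass on the lags `r ≥ aN` alone. [this cell] -/
theorem boundedResponse_of_subdiffusiveBondHeat_lateTailFloor {a b : ℝ} (ha : 0 ≤ a) (hb : b ≤ 1) (hS : SubdiffusiveBondHeat)
    (hL : LateTailFloor a b 1) : BoundedResponse :=
  boundedResponse_of_bathHeatPoint_bathTailFloor (bathHeatPoint_one_of_subdiffusiveBondHeat hS)
    ((lateTailFloor_iff_bathTailFloor ha hb).1 hL)

/-- **11071 modulo (S) = the late floor** (`a ≥ 0`, `b ≤ 1`). [this cell] -/
theorem boundedResponse_iff_lateTailFloor_of_subdiffusiveBondHeat {a b : ℝ} (ha : 0 ≤ a) (hb : b ≤ 1) (hS : SubdiffusiveBondHeat) :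
    BoundedResponse ↔ LateTailFloor a b 1 :=
  ⟨lateTailFloor_of_boundedResponse ha hb, boundedResponse_of_subdiffusiveBondHeat_lateTailFloor ha hb hS⟩

end Summit.AtomisticToContinuum.FouriersLaw.Theorems.BoundedResponse.HeatSpreading

end
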